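import Summits.AtomisticToContinuum.FouriersLaw.Theorems.ExtensiveSnapshotIrreversibility.Negative.TiltedCriterion

/-!
# `ExtensiveSnapshotIrreversibility` — lower half of the tilted sandwich (tightness lemma,
cdisprove cycle 2)

Support file for crux item `stmt-AtomisticToContinuum-9121` (route `BondHeatUncertainty`).
Companion of `Negative/TiltedCriterion.lean`: for `μ = μ₀.tilted φ` with `μ₀` a flip-invariant
probability measure and `d := φ - φ∘Θ` square-integrable under `μ`,

  `½ ∫ d² e^{-d/2} dμ ≤ KL(μ ‖ Θ_*μ) ≤ ∫ d² dμ`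

(`klDiv_flip_tilted_ge_integral_sq_exp` below; upper half `klDiv_flip_tilted_le_integral_sq` in
`TiltedCriterion`).  The lower half comes from `(a-b)² e^{(a+b)/2} ≤ (a-b)(e^a-e^b)` (`x ≤ sinh x`
for `x ≥ 0`) and flip-invariance of `μ₀`.  Read at `d = δ·(h - h∘Θ) + o(δ)`: both halves are
`2δ²‖h^odd‖²(1 + o(1))` up to the factor `2`, so the second-order coefficient `K_N` of the crux is
pinned between (the `liminf`/`limsup` of) `½δ⁻²∫d²e^{-d/2}dμ_δ` and `δ⁻²∫d²dμ_δ` by elementary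
means — no second-order perturbation theory of the steady state is needed to BOUND `K_N` from
either side, only the `L²(μ_δ)`-size of the odd log-density.  For a refuter: a strengthening of the
crux (smaller power of `N`, `o(δ²)`) dies as soon as `∫ d_δ² e^{-d_δ/2} dμ_δ` is shown large; for a
prover: the crux follows from `∫ d_δ² dμ_δ ≤ C·N·δ²`.
-/

namespace Summit.AtomisticToContinuum.FouriersLaw.Theorems.ExtensiveSnapshotIrreversibility.Negative

open MeasureTheory Filter Topology InformationTheory Real
open scoped ENNReal
open Literature.MathematicalPhysics.KineticTheory.HeatConduction

variable {N : ℕ}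

/-- pointwise: `(a - b)² e^{(a+b)/2} ≤ (a - b)(e^a - e^b)` (i.e. `x ≤ 2 sinh (x/2)` for `x ≥ 0`).
[folklore] -/
theorem sq_mul_exp_half_le_sub_mul_exp_sub_exp (a b : ℝ) :
    (a - b) ^ 2 * exp ((a + b) / 2) ≤ (a - b) * (exp a - exp b) := by
  -- `e^a - e^b = e^{(a+b)/2} (e^{x/2} - e^{-x/2})`, `x = a - b`
  have hfac : exp a - exp b = exp ((a + b) / 2) * (exp ((a - b) / 2) - exp (-((a - b) / 2))) := by
    rw [mul_sub, ← exp_add, ← exp_add]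
    congr 1 <;> congr 1 <;> ring
  have hsinh : exp ((a - b) / 2) - exp (-((a - b) / 2)) = 2 * sinh ((a - b) / 2) := by
    rw [Real.sinh_eq]; ring
  rw [hfac, hsinh]
  have hm := exp_pos ((a + b) / 2)
  rcases le_total 0 (a - b) with h | h
  · have h1 : (a - b) / 2 ≤ sinh ((a - b) / 2) := Real.self_le_sinh_iff.2 (by linarith)
    have h2 : (a - b) ≤ 2 * sinh ((a - b) / 2) := by linarith
    calc (a - b) ^ 2 * exp ((a + b) / 2) = (a - b) * (exp ((a + b) / 2) * (a - b)) := by ring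
      _ ≤ (a - b) * (exp ((a + b) / 2) * (2 * sinh ((a - b) / 2))) :=
          mul_le_mul_of_nonneg_left (mul_le_mul_of_nonneg_left h2 hm.le) h
  · have h1 : sinh ((a - b) / 2) ≤ (a - b) / 2 := Real.sinh_le_self_iff.2 (by linarith)
    have h2 : 2 * sinh ((a - b) / 2) ≤ (a - b) := by linarith
    calc (a - b) ^ 2 * exp ((a + b) / 2) = (a - b) * (exp ((a + b) / 2) * (a - b)) := by ring
      _ ≤ (a - b) * (exp ((a + b) / 2) * (2 * sinh ((a - b) / 2))) :=
          mul_le_mul_of_nonpos_left (mul_le_mul_of_nonneg_left h2 hm.le) h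

/-- AM–GM for exponentials: `e^{(a+b)/2} ≤ (e^a + e^b)/2`. [folklore] -/
theorem exp_half_add_le (a b : ℝ) : exp ((a + b) / 2) ≤ (exp a + exp b) / 2 := by
  have h := sq_nonneg (exp (a / 2) - exp (b / 2))
  have ha : exp a = exp (a / 2) * exp (a / 2) := by rw [← exp_add]; congr 1; ring
  have hb : exp b = exp (b / 2) * exp (b / 2) := by rw [← exp_add]; congr 1; ring
  have hab : exp ((a + b) / 2) = exp (a / 2) * exp (b / 2) := by rw [← exp_add]; congr 1; ring
  nlinarith [h, ha, hb, hab]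

variable {μ₀ : Measure (PhaseSpace N)}

/-- **Lower half of the tilted sandwich**: for `μ = μ₀.tilted φ`, `μ₀` a flip-invariant
probability measure, `d := φ - φ∘Θ ∈ L²(μ)`:  `½ ∫ d² e^{-d/2} dμ ≤ KL(μ ‖ Θ_*μ)`.
[folklore] -/
theorem klDiv_flip_tilted_ge_integral_sq_exp [IsProbabilityMeasure μ₀]
    (hinv : μ₀.map (fun x : PhaseSpace N => (x.1, -x.2)) = μ₀)
    {φ : PhaseSpace N → ℝ} (hφm : Measurable φ) (hexp : Integrable (fun x => exp (φ x)) μ₀)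
    (h2 : Integrable (fun x => (φ x - φ (x.1, -x.2)) ^ 2) (μ₀.tilted φ)) :
    ENNReal.ofReal ((1 / 2 : ℝ) * ∫ x, (φ x - φ (x.1, -x.2)) ^ 2 *
        exp (-((φ x - φ (x.1, -x.2)) / 2)) ∂(μ₀.tilted φ)) ≤
      klDiv (μ₀.tilted φ) ((μ₀.tilted φ).map (fun x : PhaseSpace N => (x.1, -x.2))) := by
  set d : PhaseSpace N → ℝ := fun x => φ x - φ (x.1, -x.2) with hd
  have hm : Measurable (fun x : PhaseSpace N => (x.1, -x.2)) := (momentumReversal N).measurable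
  have hdm : Measurable d := hφm.sub (hφm.comp hm)
  have hdodd : ∀ x : PhaseSpace N, d (x.1, -x.2) = -d x := fun x => by simp [hd]
  haveI : IsProbabilityMeasure (μ₀.tilted φ) := isProbabilityMeasure_tilted hexp
  -- `d ∈ L¹(μ)`
  have h1 : Integrable d (μ₀.tilted φ) := by
    refine Integrable.mono' ((integrable_const (1 : ℝ)).add h2) hdm.aestronglyMeasurable
      (ae_of_all _ fun x => ?_)
    rw [Real.norm_eq_abs]
    change |d x| ≤ 1 + (d x) ^ 2
    rcases le_total |d x| 1 with h | h
    · linarith [sq_nonneg (d x)]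
    · have : |d x| ≤ |d x| ^ 2 := by nlinarith
      rw [sq_abs] at this; linarith
  have hfin := (klDiv_flip_tilted_ne_top_iff hinv hφm hexp).2 h1
  rw [← ENNReal.ofReal_toReal hfin, toReal_klDiv_flip_tilted hinv hφm hexp]
  refine ENNReal.ofReal_le_ofReal ?_
  -- weighted `μ₀`-integrals
  set Z := ∫ x, exp (φ x) ∂μ₀ with hZ
  have hZpos : 0 < Z := integral_exp_pos hexp
  have hw1 : Integrable (fun x => exp (φ x) * d x) μ₀ := by
    have := (integrable_tilted_iff hexp d).1 h1; simpa [smul_eq_mul] using this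
  have hw2 : Integrable (fun x => exp (φ x) * d x ^ 2) μ₀ := by
    have := (integrable_tilted_iff hexp (fun x => d x ^ 2)).1 h2; simpa [smul_eq_mul] using this
  have hw1' : Integrable (fun x => exp (φ (x.1, -x.2)) * d x) μ₀ := by
    have h := (integrable_comp_flip_iff μ₀ hinv (fun x => -(exp (φ x) * d x))).2 hw1.neg
    refine h.congr (ae_of_all _ fun x => ?_)
    simp only [hdodd x]; ring
  have hw2' : Integrable (fun x => exp (φ (x.1, -x.2)) * d x ^ 2) μ₀ := by
    have h := (integrable_comp_flip_iff μ₀ hinv (fun x => exp (φ x) * d x ^ 2)).2 hw2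
    refine h.congr (ae_of_all _ fun x => ?_)
    simp only [hdodd x]; ring
  have hI1 : ∫ x, exp (φ (x.1, -x.2)) * d x ∂μ₀ = -∫ x, exp (φ x) * d x ∂μ₀ := by
    rw [← integral_neg, ← integral_comp_flip μ₀ hinv (fun x => -(exp (φ x) * d x))]
    refine integral_congr_ae (ae_of_all _ fun x => ?_)
    simp only [hdodd x]; ring
  -- the symmetric weight `e^{(φ+φΘ)/2} = e^{φ} e^{-d/2}`, integrable since `≤ ½(e^φ + e^{φΘ})`
  have hmid : ∀ x, exp ((φ x + φ (x.1, -x.2)) / 2) = exp (φ x) * exp (-(d x / 2)) := fun x => by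
    rw [← exp_add]; congr 1; simp only [hd]; ring
  have hdom : Integrable (fun x => (exp (φ x) * d x ^ 2 + exp (φ (x.1, -x.2)) * d x ^ 2) / 2) μ₀ :=
    (hw2.add hw2').div_const 2
  have hwm : Integrable (fun x => d x ^ 2 * exp ((φ x + φ (x.1, -x.2)) / 2)) μ₀ := by
    refine Integrable.mono' hdom
      ((hdm.pow_const 2).mul ((hφm.add (hφm.comp hm)).div_const 2).exp).aestronglyMeasurable
      (ae_of_all _ fun x => ?_)
    rw [Real.norm_eq_abs, abs_of_nonneg (by positivity)]
    have hag := exp_half_add_le (φ x) (φ (x.1, -x.2))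
    have hd2 : 0 ≤ d x ^ 2 := sq_nonneg _
    nlinarith [mul_le_mul_of_nonneg_left hag hd2]
  -- pointwise `d² e^{mid} ≤ d (e^φ - e^{φΘ})`, integrated: `∫ d² e^{mid} ≤ 2 ∫ e^φ d`
  have hpt : ∀ x, d x ^ 2 * exp ((φ x + φ (x.1, -x.2)) / 2) ≤
      exp (φ x) * d x - exp (φ (x.1, -x.2)) * d x := fun x => by
    have := sq_mul_exp_half_le_sub_mul_exp_sub_exp (φ x) (φ (x.1, -x.2))
    simp only [hd] at this ⊢
    nlinarith [this]
  have hint : ∫ x, d x ^ 2 * exp ((φ x + φ (x.1, -x.2)) / 2) ∂μ₀ ≤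
      ∫ x, (exp (φ x) * d x - exp (φ (x.1, -x.2)) * d x) ∂μ₀ :=
    integral_mono hwm (hw1.sub hw1') hpt
  rw [integral_sub hw1 hw1', hI1] at hint
  -- back to `μ`
  rw [integral_tilted, integral_tilted]
  simp only [smul_eq_mul]
  change (1 / 2 : ℝ) * ∫ x, exp (φ x) / Z * (d x ^ 2 * exp (-(d x / 2))) ∂μ₀ ≤
    ∫ x, exp (φ x) / Z * d x ∂μ₀
  have e1 : ∫ x, exp (φ x) / Z * (d x ^ 2 * exp (-(d x / 2))) ∂μ₀ =
      Z⁻¹ * ∫ x, d x ^ 2 * exp ((φ x + φ (x.1, -x.2)) / 2) ∂μ₀ := by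
    rw [← integral_const_mul]
    refine integral_congr_ae (ae_of_all _ fun x => ?_)
    beta_reduce
    rw [hmid x]; ring
  have e2 : ∫ x, exp (φ x) / Z * d x ∂μ₀ = Z⁻¹ * ∫ x, exp (φ x) * d x ∂μ₀ := by
    rw [← integral_const_mul]
    refine integral_congr_ae (ae_of_all _ fun x => ?_)
    ring
  rw [e1, e2]
  have hZi : 0 ≤ Z⁻¹ := inv_nonneg.2 hZpos.le
  nlinarith [mul_le_mul_of_nonneg_left hint hZi]

end Summit.AtomisticToContinuum.FouriersLaw.Theorems.ExtensiveSnapshotIrreversibility.Negative
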